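import Mathlib.Analysis.SpecialFunctions.Pow.Real
import Literature.Computability.AlgebraicComplexity.BorderRankCWThm42
import HarnessLib

/-!
# A kernel-checkable certificate format for the real solution of CGLV Thm. 4.2 (`bR_S(det₃) ≤ 17`)

Topic `Literature/Computability/AlgebraicComplexity`; sibling of `BorderRankCWThm42.lean`
(Conner–Gesmundo–Landsberg–Ventura, *Rank and border rank of Kronecker powers of tensors and
Strassen's laser method*, comput. complexity 31 (2022) = arXiv:1909.04785v2, Thm. 4.2), which
reduces Thm. 4.2 to the named fact `CGLV2022_br17RealSolution`: the polynomial system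
`CGLVBr17System z` on the `44` coefficients `z_j` of the printed forms `L₁(t), …, L₁₇(t)` has a real
solution. In the source the solution is computer-assisted (§5 and Appendix C of the
supplementary material): `z_j = ∛y_j`, `y_j ∈ K = ℚ[y]/(p)`, `p` the printed polynomial of
degree `27`, the verification being exact arithmetic in `K` and cubic extensions of `K`
(Macaulay2). This file is the data-independent half of a Lean replay of that verification: a
certificate FORMAT (`Cert`), a Boolean CHECKER (`Cert.checkDeg`) that the kernel can run
(`decide +kernel`), and its SOUNDNESS (`Cert.realSolution`: a certificate all of whose three
degree slices pass yields `CGLV2022_br17RealSolution`). The certificate itself is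
`BorderRankCWThm42CertData.lean`, the kernel run and the discharge `CGLV2022_br17RealSolution_holds`
are `BorderRankCWThm42Cert.lean`. Everything auxiliary lives in the sub-namespace `Br17Cert`.

## The shape of the certificate (a Kummer-theoretic reformulation of the authors' check)

The `44` cubes `y_j = z_j³ ∈ K` generate a subgroup of `K*/K*³` of `𝔽₃`-rank `6`; with a basis
`W₁, …, W₆ ∈ K` (six of the `y_j`) every `z_j` is `r_j(y*) · ∏ᵢ uᵢ^{e_ji}` with `r_j ∈ K`,
`e_ji ∈ {0, 1, 2}` and `uᵢ = ∛(Wᵢ(y*))` real (this is the authors' "at most one cubic extension per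
equation", globally). Hence every cubic monomial `z_a z_b z_c` equals `V(y*) · ∏ᵢ uᵢ^{εᵢ}` with
`ε = (e_a + e_b + e_c) mod 3` and `V = r_a r_b r_c ∏ᵢ Wᵢ^{⌊(e_a+e_b+e_c)ᵢ/3⌋} ∈ K`
(`Cert.entry`, `Model.entry_sound`), and an equation `∑ c_m z^m = rhs` (`rhs ∈ ℤ`) of the system
FOLLOWS from the identities in `K`: "the monomials of class `ε = 0` sum to `rhs`, those of every
other class sum to `0`" (`buckets`, `checkBuckets`; no linear independence of the `u^ε` over `K`
is needed or claimed, and no division: the `z_j` are DEFINED as the products above, `Model.z`).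

## Contents

* `peval`, `padd`, `psmul`, `pmulRaw`, `plin`, `pred`, `pmul`: dense integer polynomials as
  ascending coefficient lists, reduction modulo the monic `p` (`pP`) through the table
  `pYT = [y²⁷, …, y⁷⁹] mod p`, with `peval_pmul : p(y) = 0 → (a·b mod p)(y) = a(y) b(y)`. The four
  hot loops are written with `List.rec` (the kernel evaluates the recursor directly; compiled
  structural recursion goes through `brecOn` and was measured ≈ 3× slower), hence the
  `noncomputable section`.
* `KQ`: elements `num(y)/(dp+1)` of `K` (denominator stored minus one), `mul/smul/add/npow/lsum`,
  the test `isInt`, and their values `KQ.eval` in a field of characteristic `0`.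
* `vadd`, `vtrim`, `upow u ε = ∏ uᵢ^{εᵢ}`, `wpow W q = ∏ Wᵢ^{qᵢ}` and `upow_modDiv`,
  `upow_cube_eq_wpow` (`uᵢ³ = Wᵢ(y)`).
* `Cert` (fields `R E W monos`), `Cert.ofRaw`, accessors `rAt/eAt` (`1`/`0` at the index `0` = the
  constant entries `±1`, `±t` of the forms), the memo tables `pmemo` (pairs) and `memo`
  (monomials), `buckets`, `checkBuckets`, the symbolic system `terms deg a b c` computed from the
  vendored tables `cglvBr17ConstSpec/cglvBr17LinSpec` themselves (`spec`, `pat`, `termOf`;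
  `sys0_eq/sys1_eq/sys2_eq` identify it with the three components of `CGLVBr17System`), `rhsOf`
  (`ε ⊗ ε` through `leviCivita3Table`), `coordCheck`, `Cert.checkDeg` (one `t`-degree, all `9³`
  coordinates; sliced by degree so that one kernel run stays within memory).
* `Model C` (a real root `y` of `p`, reals `uᵢ` with `uᵢ³ = Wᵢ(y)`), `Model.z`, and the soundness
  chain `tsum_eq_bval` → `bval_of_checkBuckets` → `Model.tsum_terms_eq` → `Model.system`.
* `exists_root_pP` (`p(-4) < 0 < p(-3)`, intermediate value theorem — the root found is the
  `y* ≈ -3.1197` the data refer to, but any real root would do), `exists_cube_root`, and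
  `Cert.realSolution`.

## References

* A. Conner, F. Gesmundo, J. M. Landsberg, E. Ventura, *Rank and border rank of Kronecker powers of
  tensors and Strassen's laser method*, comput. complexity 31 (2022) = arXiv:1909.04785v2: Thm. 4.2,
  its proof (the forms `Lᵢ(t)`, the polynomial `p`), §5 (how the algebraic solution was found and
  checked), Supplementary Material Appendix C (`Det3_borderRank17.tar.gz`).
  [ConnerGesmundoLandsbergVentura2022]

## Design choices / not here

* No `native_decide`, no extra axioms: the checker is run by the kernel (`decide +kernel`).
* The checker never trusts the data: a wrong certificate makes `checkDeg` return `false`; the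
  soundness theorem is unconditional in the data.
* Not here: the data (`…CertData.lean`), the kernel run (`…Cert.lean`), and any claim that the
  `z_j` of a model are the authors' `∛y_j` (true for the vendored data, not needed).
-/

noncomputable section

open scoped BigOperators

namespace Literature.Computability.AlgebraicComplexity

namespace Br17Cert

/-! ## Dense integer polynomials (ascending coefficient lists) -/

section Poly

variable {R : Type*} [CommRing R]

/-- Evaluation at `y` of an ascending coefficient list: `peval y [c₀, c₁, …] = c₀ + c₁ y + ⋯`. [folklore] -/
def peval (y : R) : List ℤ → R
  | [] => 0
  | c :: cs => (c : R) + y * peval y cs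

/-- Coefficientwise sum, the shorter list padded with zeros (written with the recursor: the kernel
evaluates `List.rec` about three times faster than compiled structural recursion). [folklore] -/
def padd (a b : List ℤ) : List ℤ :=
  List.rec (motive := fun _ => List ℤ → List ℤ) (fun l => l)
    (fun x xs ih l => List.casesOn (motive := fun _ => List ℤ) l (x :: xs)
      (fun y ys => Int.add x y :: ih ys)) a b

/-- Integer multiple of a coefficient list (recursor form). [folklore] -/
def psmul (c : ℤ) (l : List ℤ) : List ℤ :=
  List.rec (motive := fun _ => List ℤ) [] (fun a _ ih => Int.mul c a :: ih) l

/-- Schoolbook product (recursor form). [folklore] -/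
def pmulRaw (a b : List ℤ) : List ℤ :=
  List.rec (motive := fun _ => List ℤ) [] (fun x _ ih => padd (psmul x b) (0 :: ih)) a

/-- `∑ₖ cₖ · tₖ` for coefficients `cs` against a table of lists `ts` (recursor form). [folklore] -/
def plin (cs : List ℤ) (ts : List (List ℤ)) : List ℤ :=
  List.rec (motive := fun _ => List (List ℤ) → List ℤ) (fun _ => [])
    (fun c _ ih ts => List.casesOn (motive := fun _ => List ℤ) ts []
      (fun t ts' => padd (psmul c t) (ih ts'))) cs ts

/-- `l` is the constant `k` (all higher coefficients vanish). [folklore] -/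
def pisConst (k : ℤ) : List ℤ → Bool
  | [] => k == 0
  | a :: as => a == k && as.all (· == 0)

/-- The empty list is `0`. [folklore] -/
@[simp] theorem peval_nil (y : R) : peval y [] = 0 := rfl

/-- Horner step. [folklore] -/
@[simp] theorem peval_cons (y : R) (c : ℤ) (cs : List ℤ) :
    peval y (c :: cs) = (c : R) + y * peval y cs := rfl

/-- `padd` equation. [folklore] -/
@[simp] theorem padd_nil (l : List ℤ) : padd [] l = l := rfl

/-- `padd` equation. [folklore] -/
@[simp] theorem padd_cons_nil (a : ℤ) (as : List ℤ) : padd (a :: as) [] = a :: as := rfl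

/-- `padd` equation. [folklore] -/
@[simp] theorem padd_cons_cons (a b : ℤ) (as bs : List ℤ) :
    padd (a :: as) (b :: bs) = (a + b) :: padd as bs := rfl

/-- `psmul` equation. [folklore] -/
@[simp] theorem psmul_nil (c : ℤ) : psmul c [] = [] := rfl

/-- `psmul` equation. [folklore] -/
@[simp] theorem psmul_cons (c a : ℤ) (as : List ℤ) : psmul c (a :: as) = c * a :: psmul c as := rfl

/-- `pmulRaw` equation. [folklore] -/
@[simp] theorem pmulRaw_nil (b : List ℤ) : pmulRaw [] b = [] := rfl

/-- `pmulRaw` equation. [folklore] -/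
@[simp] theorem pmulRaw_cons (a : ℤ) (as b : List ℤ) :
    pmulRaw (a :: as) b = padd (psmul a b) (0 :: pmulRaw as b) := rfl

/-- `plin` equation. [folklore] -/
@[simp] theorem plin_nil (ts : List (List ℤ)) : plin [] ts = [] := rfl

/-- `plin` equation. [folklore] -/
@[simp] theorem plin_cons_nil (c : ℤ) (cs : List ℤ) : plin (c :: cs) [] = [] := rfl

/-- `plin` equation. [folklore] -/
@[simp] theorem plin_cons_cons (c : ℤ) (cs : List ℤ) (t : List ℤ) (ts : List (List ℤ)) :
    plin (c :: cs) (t :: ts) = padd (psmul c t) (plin cs ts) := rfl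

/-- `padd` is addition. [folklore] -/
theorem peval_padd (y : R) : ∀ a b : List ℤ, peval y (padd a b) = peval y a + peval y b
  | [], l => by simp
  | a :: as, [] => by simp
  | a :: as, b :: bs => by
    rw [padd_cons_cons, peval_cons, peval_cons, peval_cons, peval_padd y as bs, Int.cast_add]
    ring

/-- `psmul` is scalar multiplication. [folklore] -/
theorem peval_psmul (y : R) (c : ℤ) : ∀ a : List ℤ, peval y (psmul c a) = (c : R) * peval y a
  | [] => by simp
  | a :: as => by
    rw [psmul_cons, peval_cons, peval_cons, peval_psmul y c as, Int.cast_mul]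
    ring

/-- `pmulRaw` is multiplication. [folklore] -/
theorem peval_pmulRaw (y : R) : ∀ a b : List ℤ, peval y (pmulRaw a b) = peval y a * peval y b
  | [], b => by simp
  | a :: as, b => by
    rw [pmulRaw_cons, peval_padd, peval_psmul, peval_cons, peval_cons, peval_pmulRaw y as b,
      Int.cast_zero]
    ring

/-- Evaluation of a concatenation. [folklore] -/
theorem peval_append (y : R) :
    ∀ a b : List ℤ, peval y (a ++ b) = peval y a + y ^ a.length * peval y b
  | [], b => by simp
  | a :: as, b => by
    rw [List.cons_append, peval_cons, peval_cons, peval_append y as b, List.length_cons, pow_succ]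
    ring

/-- A list recognised as the constant `k` evaluates to `k`. [folklore] -/
theorem peval_eq_of_pisConst (y : R) (k : ℤ) : ∀ l : List ℤ, pisConst k l = true → peval y l = k
  | [], h => by
    simp only [pisConst, beq_iff_eq] at h
    simp [h]
  | a :: as, h => by
    simp only [pisConst, Bool.and_eq_true, beq_iff_eq, List.all_eq_true] at h
    obtain ⟨rfl, h2⟩ := h
    suffices hz : peval y as = 0 by simp [hz]
    induction as with
    | nil => rfl
    | cons b bs ih =>
      have hb : b = 0 := h2 b (by simp)
      have := ih (fun x hx => h2 x (by simp [hx]))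
      simp [hb, this]

/-- Evaluation at an integer, cast. [folklore] -/
theorem peval_intCast (k : ℤ) : ∀ l : List ℤ, peval (k : R) l = ((peval k l : ℤ) : R)
  | [] => by simp
  | a :: as => by simp [peval_intCast k as]

/-- Length of a sum. [folklore] -/
@[simp] theorem length_padd : ∀ a b : List ℤ, (padd a b).length = max a.length b.length
  | [], l => by simp
  | a :: as, [] => by simp
  | a :: as, b :: bs => by simp [length_padd as bs, Nat.succ_max_succ]

/-- Length of a multiple. [folklore] -/
@[simp] theorem length_psmul (c : ℤ) : ∀ a : List ℤ, (psmul c a).length = a.length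
  | [] => rfl
  | a :: as => by simp [length_psmul c as]

/-- Length of a product. [folklore] -/
theorem length_pmulRaw_le : ∀ a b : List ℤ, (pmulRaw a b).length ≤ a.length + b.length
  | [], b => by simp
  | a :: as, b => by
    have := length_pmulRaw_le as b
    simp only [pmulRaw_cons, length_padd, length_psmul, List.length_cons]
    omega

/-! ### Reduction modulo the CGLV polynomial `p` -/

/-- The polynomial `p = x²⁷ - 2x²⁶ + 17x²⁵ - ⋯ + 1146880x - 520192` of the proof of CGLV Thm. 4.2,
ascending coefficients (monic). [cite: ConnerGesmundoLandsbergVentura2022, Thm. 4.2 (proof)] -/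
def pP : List ℤ :=
  [-520192, 1146880, -1136640, 684032, -42240, -537600, 1092352, -1236736, 762736, -196096,
    -267416, 427344, -308611, 138860, 10444, -72973, 72133, -50663, 25738, -10901, 3451, -726, 52,
    81, -29, 17, -2, 1]

/-- `y²⁷ mod p`: minus the 27 low coefficients of `p`. [folklore] -/
def pT : List ℤ := psmul (-1) (pP.take 27)

/-- From `Y ≡ y^m` (length `≤ 27`) to `y^{m+1} mod p`. [folklore] -/
def pstep (l : List ℤ) : List ℤ := padd (0 :: l.take 26) (plin (l.drop 26) [pT])

/-- The table `[y^m, y^{m+1}, …] mod p`, `n` entries starting from `cur ≡ y^m`. [folklore] -/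
def ptab : ℕ → List ℤ → List (List ℤ)
  | 0, _ => []
  | n + 1, cur => cur :: ptab n (pstep cur)

/-- `[y²⁷, y²⁸, …, y⁷⁹] mod p`. [folklore] -/
def pYT : List (List ℤ) := ptab 53 pT

/-- Reduction modulo `p` of a list of length `≤ 80` to one of length `≤ 27`. [folklore] -/
def pred (l : List ℤ) : List ℤ := padd (l.take 27) (plin (l.drop 27) pYT)

/-- Product modulo `p` (operands of length `≤ 27`). [folklore] -/
def pmul (a b : List ℤ) : List ℤ := pred (pmulRaw a b)

/-- Table invariant: consecutive powers of `y` starting at `y^m`. [folklore] -/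
def TabOK (y : R) : ℕ → List (List ℤ) → Prop
  | _, [] => True
  | m, t :: ts => peval y t = y ^ m ∧ TabOK y (m + 1) ts

/-- `pT` is `y²⁷` at a root of `p`. [folklore] -/
theorem peval_pT {y : R} (hy : peval y pP = 0) : peval y pT = y ^ 27 := by
  have h := peval_append y (pP.take 27) (pP.drop 27)
  rw [List.take_append_drop] at h
  have hd : pP.drop 27 = [1] := by decide
  have hl : (pP.take 27).length = 27 := by decide
  rw [hy, hd, hl] at h
  simp only [peval_cons, peval_nil, Int.cast_one, mul_zero, add_zero, mul_one] at h
  rw [pT, peval_psmul]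
  push_cast
  linear_combination h

/-- `pT` has length `27`. [folklore] -/
theorem length_pT : pT.length = 27 := by
  rw [pT, length_psmul]
  decide

/-- `plin` against a table of consecutive powers. [folklore] -/
theorem peval_plin (y : R) :
    ∀ (cs : List ℤ) (ts : List (List ℤ)) (m : ℕ), TabOK y m ts → cs.length ≤ ts.length →
      peval y (plin cs ts) = y ^ m * peval y cs
  | [], ts, m, _, _ => by simp
  | c :: cs, [], m, _, h => by simp at h
  | c :: cs, t :: ts, m, ht, h => by
    obtain ⟨ht1, ht2⟩ := ht
    rw [plin_cons_cons, peval_padd, peval_psmul, ht1, peval_cons,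
      peval_plin y cs ts (m + 1) ht2 (by simpa using h)]
    ring

/-- Length of `plin` against a table of lists of length `≤ 27`. [folklore] -/
theorem length_plin_le :
    ∀ (cs : List ℤ) (ts : List (List ℤ)), (∀ t ∈ ts, t.length ≤ 27) → (plin cs ts).length ≤ 27
  | [], ts, _ => by simp
  | c :: cs, [], _ => by simp
  | c :: cs, t :: ts, h => by
    have h1 := h t (by simp)
    have h2 := length_plin_le cs ts (fun t' ht' => h t' (by simp [ht']))
    simp only [plin_cons_cons, length_padd, length_psmul]
    omega

/-- `pstep` multiplies by `y`. [folklore] -/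
theorem peval_pstep {y : R} (hy : peval y pP = 0) (l : List ℤ) (hl : l.length ≤ 27) :
    peval y (pstep l) = y * peval y l := by
  have h := peval_append y (l.take 26) (l.drop 26)
  rw [List.take_append_drop] at h
  have htab : TabOK y 27 [pT] := ⟨peval_pT hy, trivial⟩
  rw [pstep, peval_padd, peval_cons, h, peval_plin y (l.drop 26) [pT] 27 htab
    (by simp only [List.length_drop, List.length_singleton]; omega)]
  rcases Nat.lt_or_ge l.length 27 with h27 | h27
  · have hz : l.drop 26 = [] := List.drop_eq_nil_of_le (by omega)
    simp [hz]
  · have hlen : (l.take 26).length = 26 := by rw [List.length_take]; omega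
    rw [hlen]
    push_cast
    ring

/-- `pstep` keeps the length `≤ 27`. [folklore] -/
theorem length_pstep (l : List ℤ) : (pstep l).length ≤ 27 := by
  have := length_plin_le (l.drop 26) [pT] (by simp [length_pT])
  simp only [pstep, length_padd, List.length_cons, List.length_take]
  omega

/-- The table built by `ptab` consists of consecutive powers. [folklore] -/
theorem tabOK_ptab {y : R} (hy : peval y pP = 0) :
    ∀ (n m : ℕ) (cur : List ℤ), peval y cur = y ^ m → cur.length ≤ 27 → TabOK y m (ptab n cur)
  | 0, m, cur, _, _ => trivial
  | n + 1, m, cur, hc, hl =>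
    ⟨hc, tabOK_ptab hy n (m + 1) (pstep cur) (by rw [peval_pstep hy cur hl, hc, pow_succ]; ring)
      (length_pstep cur)⟩

/-- The table entries have length `≤ 27`. [folklore] -/
theorem ptab_length_le :
    ∀ (n : ℕ) (cur : List ℤ), cur.length ≤ 27 → ∀ t ∈ ptab n cur, t.length ≤ 27
  | 0, cur, _ => by simp [ptab]
  | n + 1, cur, h => by
    intro t ht
    simp only [ptab, List.mem_cons] at ht
    rcases ht with rfl | ht
    · exact h
    · exact ptab_length_le n (pstep cur) (length_pstep cur) t ht

/-- `pYT` is `[y²⁷, …, y⁷⁹]` at a root of `p`. [folklore] -/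
theorem tabOK_pYT {y : R} (hy : peval y pP = 0) : TabOK y 27 pYT :=
  tabOK_ptab hy 53 27 pT (peval_pT hy) length_pT.le

/-- `pYT` has `53` entries. [folklore] -/
theorem length_pYT : pYT.length = 53 := by
  simp [pYT]
  suffices h : ∀ n cur, (ptab n cur).length = n from h 53 pT
  intro n
  induction n with
  | zero => intro cur; rfl
  | succ n ih => intro cur; simp [ptab, ih]

/-- The entries of `pYT` have length `≤ 27`. [folklore] -/
theorem pYT_length_le : ∀ t ∈ pYT, t.length ≤ 27 := ptab_length_le 53 pT length_pT.le

/-- Reduction modulo `p` does not change the value at a root of `p`. [folklore] -/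
theorem peval_pred {y : R} (hy : peval y pP = 0) (l : List ℤ) (hl : l.length ≤ 80) :
    peval y (pred l) = peval y l := by
  have h := peval_append y (l.take 27) (l.drop 27)
  rw [List.take_append_drop] at h
  rw [pred, peval_padd, h, peval_plin y (l.drop 27) pYT 27 (tabOK_pYT hy)
    (by rw [length_pYT, List.length_drop]; omega)]
  rcases Nat.lt_or_ge l.length 27 with h27 | h27
  · have : l.drop 27 = [] := List.drop_eq_nil_of_le (by omega)
    simp [this]
  · rw [List.length_take, min_eq_left h27]

/-- Reduced lists have length `≤ 27`. [folklore] -/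
theorem length_pred (l : List ℤ) : (pred l).length ≤ 27 := by
  have := length_plin_le (l.drop 27) pYT pYT_length_le
  simp only [pred, length_padd, List.length_take]
  omega

/-- `pmul` is multiplication at a root of `p`. [folklore] -/
theorem peval_pmul {y : R} (hy : peval y pP = 0) (a b : List ℤ) (ha : a.length ≤ 27)
    (hb : b.length ≤ 27) : peval y (pmul a b) = peval y a * peval y b := by
  rw [pmul, peval_pred hy _ (by have := length_pmulRaw_le a b; omega), peval_pmulRaw]

/-- Products have length `≤ 27`. [folklore] -/
theorem length_pmul (a b : List ℤ) : (pmul a b).length ≤ 27 := length_pred _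

end Poly

/-! ## Elements of `K = ℚ(y*)`: numerator polynomial and denominator -/

/-- `⟨num, dp⟩` stands for `num(y*) / (dp + 1)`: the denominator is stored minus one, so that it is
positive by construction. [folklore] -/
structure KQ where
  /-- numerator, ascending coefficients -/
  num : List ℤ
  /-- denominator minus one -/
  dp : ℕ

namespace KQ

/-- `1`. [folklore] -/
def one : KQ := ⟨[1], 0⟩

/-- `0`. [folklore] -/
def zero : KQ := ⟨[], 0⟩

/-- Product (numerators multiplied modulo `p`). [folklore] -/
def mul (a b : KQ) : KQ := ⟨pmul a.num b.num, a.dp * b.dp + a.dp + b.dp⟩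

/-- Integer multiple. [folklore] -/
def smul (c : ℤ) (a : KQ) : KQ := ⟨psmul c a.num, a.dp⟩

/-- Sum (cross-multiplied, not normalised). [folklore] -/
def add (a b : KQ) : KQ :=
  ⟨padd (psmul ((b.dp + 1 : ℕ) : ℤ) a.num) (psmul ((a.dp + 1 : ℕ) : ℤ) b.num),
    a.dp * b.dp + a.dp + b.dp⟩

/-- Power by repeated multiplication. [folklore] -/
def npow (a : KQ) : ℕ → KQ
  | 0 => one
  | n + 1 => mul (npow a n) a

/-- `a` is the integer `k` (its numerator is the constant `k · den`). [folklore] -/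
def isInt (a : KQ) (k : ℤ) : Bool := pisConst (k * ((a.dp + 1 : ℕ) : ℤ)) a.num

/-- Sum of a list. [folklore] -/
def lsum : List KQ → KQ
  | [] => zero
  | x :: xs => add x (lsum xs)

section Eval

variable {R : Type*} [Field R]

/-- The value `num(y) / (dp + 1)`. [folklore] -/
def eval (y : R) (a : KQ) : R := peval y a.num / ((a.dp : R) + 1)

/-- `one` is `1`. [folklore] -/
@[simp] theorem eval_one (y : R) : eval y one = 1 := by simp [eval, one]

/-- `zero` is `0`. [folklore] -/
@[simp] theorem eval_zero (y : R) : eval y zero = 0 := by simp [eval, zero]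

/-- `mul` is multiplication (at a root of `p`, operands of length `≤ 27`). [folklore] -/
theorem eval_mul {y : R} (hy : peval y pP = 0) (a b : KQ) (ha : a.num.length ≤ 27)
    (hb : b.num.length ≤ 27) : eval y (mul a b) = eval y a * eval y b := by
  rw [eval, eval, eval, div_mul_div_comm, mul, peval_pmul hy _ _ ha hb]
  congr 1
  push_cast
  ring

/-- `smul` is an integer multiple. [folklore] -/
theorem eval_smul (y : R) (c : ℤ) (a : KQ) : eval y (smul c a) = (c : R) * eval y a := by
  rw [eval, eval, smul, peval_psmul, mul_div_assoc]

/-- `npow` is the power (operand of length `≤ 27`), of length `≤ 27`. [folklore] -/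
theorem eval_npow {y : R} (hy : peval y pP = 0) (a : KQ) (ha : a.num.length ≤ 27) :
    ∀ n : ℕ, eval y (npow a n) = eval y a ^ n ∧ (npow a n).num.length ≤ 27
  | 0 => ⟨by rw [npow, eval_one, pow_zero], by simp [npow, one]⟩
  | n + 1 => by
    obtain ⟨h1, h2⟩ := eval_npow hy a ha n
    refine ⟨?_, length_pmul _ _⟩
    rw [npow, eval_mul hy _ _ h2 ha, h1, pow_succ]

variable [CharZero R]

/-- Denominators are non-zero in characteristic `0`. [folklore] -/
theorem dp_ne_zero (a : KQ) : ((a.dp : R) + 1) ≠ 0 := Nat.cast_add_one_ne_zero a.dp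

/-- `add` is addition. [folklore] -/
theorem eval_add (y : R) (a b : KQ) : eval y (add a b) = eval y a + eval y b := by
  rw [eval, eval, eval, div_add_div _ _ (dp_ne_zero a) (dp_ne_zero b), add, peval_padd,
    peval_psmul, peval_psmul]
  congr 1
  · push_cast; ring
  · push_cast; ring

/-- `isInt` is sound. [folklore] -/
theorem eval_of_isInt (y : R) (a : KQ) (k : ℤ) (h : isInt a k = true) : eval y a = k := by
  rw [eval, peval_eq_of_pisConst y _ _ h]
  push_cast
  field_simp

/-- `lsum` is the sum. [folklore] -/
theorem eval_lsum (y : R) : ∀ l : List KQ, eval y (lsum l) = (l.map (eval y)).sum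
  | [] => by simp [lsum]
  | x :: xs => by rw [lsum, eval_add, eval_lsum y xs, List.map_cons, List.sum_cons]

end Eval

/-- Products have length `≤ 27`. [folklore] -/
theorem length_mul (a b : KQ) : (mul a b).num.length ≤ 27 := length_pmul _ _

end KQ

/-! ## Exponent vectors of the six radicals `u₁, …, u₆` -/

/-- Componentwise sum (shorter vector padded with zeros). [folklore] -/
def vadd : List ℕ → List ℕ → List ℕ
  | [], l => l
  | a :: as, [] => a :: as
  | a :: as, b :: bs => (a + b) :: vadd as bs

/-- All entries vanish. [folklore] -/
def vzero (v : List ℕ) : Bool := v.all (· == 0)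

/-- Canonical form of an exponent vector: the all-zero tail is removed. [folklore] -/
def vtrim : List ℕ → List ℕ
  | [] => []
  | k :: ks => if vzero (k :: ks) then [] else k :: vtrim ks

/-- `∏ᵢ uᵢ^{vᵢ}`. [folklore] -/
def upow {R : Type*} [CommRing R] (u : ℕ → R) : List ℕ → R
  | [] => 1
  | k :: ks => u 0 ^ k * upow (fun i => u (i + 1)) ks

/-- `∏ᵢ Wᵢ^{qᵢ}` in `K`. [folklore] -/
def wpow : List KQ → List ℕ → KQ
  | _, [] => KQ.one
  | ws, q :: qs => KQ.mul (KQ.npow (ws.headD KQ.one) q) (wpow ws.tail qs)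

section UPow

variable {R : Type*} [Field R]

/-- `upow` equation. [folklore] -/
@[simp] theorem upow_nil (u : ℕ → R) : upow u [] = 1 := rfl

/-- `upow` equation. [folklore] -/
@[simp] theorem upow_cons (u : ℕ → R) (k : ℕ) (ks : List ℕ) :
    upow u (k :: ks) = u 0 ^ k * upow (fun i => u (i + 1)) ks := rfl

/-- `upow` turns `vadd` into a product. [folklore] -/
theorem upow_vadd : ∀ (u : ℕ → R) (a b : List ℕ), upow u (vadd a b) = upow u a * upow u b
  | u, [], l => by simp [vadd]
  | u, a :: as, [] => by simp [vadd]
  | u, a :: as, b :: bs => by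
    rw [vadd, upow_cons, upow_cons, upow_cons, upow_vadd _ as bs, pow_add]
    ring

/-- A zero vector gives `1`. [folklore] -/
theorem upow_of_vzero : ∀ (u : ℕ → R) (v : List ℕ), vzero v = true → upow u v = 1
  | u, [], _ => rfl
  | u, k :: ks, h => by
    simp only [vzero, List.all_cons, Bool.and_eq_true, beq_iff_eq] at h
    rw [upow_cons, h.1, pow_zero, one_mul, upow_of_vzero _ ks (by simpa [vzero] using h.2)]

/-- Trimming does not change the product. [folklore] -/
theorem upow_vtrim : ∀ (u : ℕ → R) (v : List ℕ), upow u (vtrim v) = upow u v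
  | u, [] => rfl
  | u, k :: ks => by
    rw [vtrim]
    split_ifs with h
    · rw [upow_of_vzero u _ h]; rfl
    · rw [upow_cons, upow_cons, upow_vtrim _ ks]

/-- Splitting exponents modulo `3`: `u^v = u^{v mod 3} · (u³)^{⌊v/3⌋}`. [folklore] -/
theorem upow_modDiv : ∀ (u : ℕ → R) (v : List ℕ),
    upow u v = upow u (v.map (· % 3)) * upow (fun i => u i ^ 3) (v.map (· / 3))
  | u, [] => by simp
  | u, k :: ks => by
    rw [List.map_cons, List.map_cons, upow_cons, upow_cons, upow_cons, upow_modDiv _ ks]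
    have hk : u 0 ^ k = u 0 ^ (k % 3) * (u 0 ^ 3) ^ (k / 3) := by
      rw [← pow_mul, ← pow_add, Nat.mod_add_div]
    rw [hk]
    ring

/-- Indexing a radicand list at `0`. [folklore] -/
theorem getD_zero_eq_headD (ws : List KQ) : ws.getD 0 KQ.one = ws.headD KQ.one := by
  cases ws <;> rfl

/-- Indexing a radicand list at `i + 1`. [folklore] -/
theorem getD_succ_eq_tail (ws : List KQ) (i : ℕ) : ws.getD (i + 1) KQ.one = ws.tail.getD i KQ.one := by
  cases ws <;> rfl

/-- With `uᵢ³ = Wᵢ(y)`, `∏ (uᵢ³)^{qᵢ} = (wpow W q)(y)`, and `wpow` has length `≤ 27`. [folklore] -/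
theorem upow_cube_eq_wpow {y : R} (hy : peval y pP = 0) :
    ∀ (ws : List KQ) (q : List ℕ) (u : ℕ → R), (∀ i, u i ^ 3 = (ws.getD i KQ.one).eval y) →
      (∀ w ∈ ws, w.num.length ≤ 27) →
      upow (fun i => u i ^ 3) q = (wpow ws q).eval y ∧ (wpow ws q).num.length ≤ 27
  | ws, [], u, _, _ => ⟨by simp [wpow], by simp [wpow, KQ.one]⟩
  | ws, q :: qs, u, hu, hw => by
    have hhead : (ws.headD KQ.one).num.length ≤ 27 := by
      cases ws with
      | nil => simp [KQ.one]
      | cons w ws' => exact hw w (by simp)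
    have htail : ∀ w ∈ ws.tail, w.num.length ≤ 27 := fun w hw' => hw w (List.mem_of_mem_tail hw')
    obtain ⟨ih1, ih2⟩ := upow_cube_eq_wpow hy ws.tail qs (fun i => u (i + 1))
      (fun i => by rw [hu (i + 1), getD_succ_eq_tail]) htail
    obtain ⟨hp1, hp2⟩ := KQ.eval_npow hy (ws.headD KQ.one) hhead q
    refine ⟨?_, KQ.length_mul _ _⟩
    rw [wpow, KQ.eval_mul hy _ _ hp2 ih2, hp1, ← ih1, upow_cons, ← getD_zero_eq_headD, ← hu 0]

end UPow

/-! ## The certificate format and its checker -/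

/-- Certificate data for a real solution of `CGLVBr17System`: elements `r_j ∈ K` and exponent
vectors `e_j` (`j = 1, …, 44`) with `z_j = r_j(y*) · ∏ᵢ uᵢ^{e_ji}`, the radicands `Wᵢ ∈ K`
(`uᵢ³ = Wᵢ(y*)`), and the list of monomials (sorted index triples, index `0` standing for the
constant `1`) to tabulate. [cite: ConnerGesmundoLandsbergVentura2022, Thm. 4.2 (proof)] -/
structure Cert where
  /-- `r_1, …, r_44` -/
  R : List KQ
  /-- `e_1, …, e_44` -/
  E : List (List ℕ)
  /-- `W_1, …, W_6` -/
  W : List KQ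
  /-- the monomials `z_a z_b z_c` (`a ≤ b ≤ c`) occurring in the system -/
  monos : List (ℕ × ℕ × ℕ)

namespace Cert

variable (C : Cert)

/-- Assembling a certificate from raw lists (numerator, denominator minus one). [folklore] -/
def ofRaw (R : List (List ℤ × ℕ)) (E : List (List ℕ)) (W : List (List ℤ × ℕ))
    (monos : List (ℕ × ℕ × ℕ)) : Cert :=
  ⟨R.map fun r => ⟨r.1, r.2⟩, E, W.map fun w => ⟨w.1, w.2⟩, monos⟩

/-- `r_j` (`1` for `j = 0` or out of range). [folklore] -/
def rAt (j : ℕ) : KQ := if 0 < j ∧ j ≤ 44 then C.R.getD (j - 1) KQ.one else KQ.one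

/-- `e_j` (`0` for `j = 0` or out of range). [folklore] -/
def eAt (j : ℕ) : List ℕ := if 0 < j ∧ j ≤ 44 then C.E.getD (j - 1) [] else []

/-- The distinct pairs `(a, b)` of the listed triples `(a, b, c)`. [folklore] -/
def pairs : List (ℕ × ℕ) :=
  C.monos.foldr (fun t acc => if acc.elem (t.1, t.2.1) then acc else (t.1, t.2.1) :: acc) []

/-- Memo table of the products `r_a r_b`. [folklore] -/
def pmemo : List ((ℕ × ℕ) × KQ) := C.pairs.map fun p => (p, KQ.mul (C.rAt p.1) (C.rAt p.2))

end Cert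

/-- Lookup by key. [folklore] -/
def mfind {α β : Type} [DecidableEq α] : List (α × β) → α → Option β
  | [], _ => none
  | kv :: rest, key => if kv.1 = key then some kv.2 else mfind rest key

namespace Cert

variable (C : Cert)

/-- `r_a r_b`, from the pair table when present. [folklore] -/
def pairVal (pm : List ((ℕ × ℕ) × KQ)) (p : ℕ × ℕ) : KQ :=
  match mfind pm p with
  | some v => v
  | none => KQ.mul (C.rAt p.1) (C.rAt p.2)

/-- The tabulated value of a monomial `z_a z_b z_c`: its `u`-class `ε = (e_a + e_b + e_c) mod 3`
(trimmed) and `V = r_a r_b r_c · ∏ᵢ Wᵢ^{⌊(e_a+e_b+e_c)ᵢ/3⌋} ∈ K`, so that `z_a z_b z_c = V(y*) · u^ε`.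
[folklore] -/
def entry (pm : List ((ℕ × ℕ) × KQ)) (t : ℕ × ℕ × ℕ) : List ℕ × KQ :=
  let ev := vadd (vadd (C.eAt t.1) (C.eAt t.2.1)) (C.eAt t.2.2)
  (vtrim (ev.map (· % 3)),
    KQ.mul (KQ.mul (C.pairVal pm (t.1, t.2.1)) (C.rAt t.2.2)) (wpow C.W (ev.map (· / 3))))

/-- The memo table of all listed monomials. [folklore] -/
def memo : List ((ℕ × ℕ × ℕ) × (List ℕ × KQ)) :=
  let pm := C.pmemo
  C.monos.map fun t => (t, C.entry pm t)

/-- Well-formedness of the data: numerators of length `≤ 27`. [folklore] -/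
def dataOK : Bool :=
  (C.R.all fun r => decide (r.num.length ≤ 27)) && (C.W.all fun w => decide (w.num.length ≤ 27))

end Cert

/-- Sorting two indices. [folklore] -/
def sort2 (a b : ℕ) : ℕ × ℕ := if a ≤ b then (a, b) else (b, a)

/-- Sorting three indices. [folklore] -/
def sort3 (a b c : ℕ) : ℕ × ℕ × ℕ :=
  if c ≤ (sort2 a b).1 then (c, (sort2 a b).1, (sort2 a b).2)
  else if c ≤ (sort2 a b).2 then ((sort2 a b).1, c, (sort2 a b).2)
  else ((sort2 a b).1, (sort2 a b).2, c)

/-- Buckets `ε ↦ S_ε ∈ K`: add `x` to the bucket of the class `k`. [folklore] -/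
def addBucket : List (List ℕ × KQ) → List ℕ → KQ → List (List ℕ × KQ)
  | [], k, x => [(k, x)]
  | b :: rest, k, x =>
    if b.1 = k then (b.1, KQ.add b.2 x) :: rest else b :: addBucket rest k x

/-- Distribute the terms `(coefficient, a, b, c)` of one coordinate into buckets (`none` if a
monomial is missing from the memo table). [folklore] -/
def buckets (memo : List ((ℕ × ℕ × ℕ) × (List ℕ × KQ))) :
    List (ℤ × ℕ × ℕ × ℕ) → Option (List (List ℕ × KQ))
  | [] => some []
  | t :: ts =>
    match buckets memo ts with
    | none => none
    | some bs =>
      if t.1 = 0 then some bs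
      else
        match mfind memo (sort3 t.2.1 t.2.2.1 t.2.2.2) with
        | none => none
        | some kv => some (addBucket bs kv.1 (KQ.smul t.1 kv.2))

/-- The buckets certify the value `rhs`: every bucket of non-zero class is `0` and the class-`0`
buckets sum to `rhs`. [folklore] -/
def checkBuckets (rhs : ℤ) (bs : List (List ℕ × KQ)) : Bool :=
  (bs.all fun b => b.1.isEmpty || b.2.isInt 0) &&
    (KQ.lsum ((bs.filter fun b => b.1.isEmpty).map fun b => b.2)).isInt rhs

/-! ### The symbolic system -/

/-- The two printed tables: `false` ↦ constant parts `A_i`, `true` ↦ `t`-linear parts `B_i`.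
[cite: ConnerGesmundoLandsbergVentura2022, Thm. 4.2 (proof)] -/
def spec : Bool → Fin 17 → Fin 3 → Fin 3 → ℤ × ℕ
  | false => cglvBr17ConstSpec
  | true => cglvBr17LinSpec

/-- Which factors are `B`'s in the `t⁰, t¹, t²` components of `∑ᵢ L_i(t)^{⊗3}`. [folklore] -/
def pat : ℕ → List (Bool × Bool × Bool)
  | 0 => [(false, false, false)]
  | 1 => [(false, false, true), (false, true, false), (true, false, false)]
  | _ => [(false, true, true), (true, false, true), (true, true, false)]

/-- The term `(c_a c_b c_c, j_a, j_b, j_c)` of row `i`, pattern `s`, at coordinate `(a, b, c)`.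
[folklore] -/
def termOf (a b c : Fin 3 × Fin 3) (i : Fin 17) (s : Bool × Bool × Bool) : ℤ × ℕ × ℕ × ℕ :=
  ((spec s.1 i a.1 a.2).1 * (spec s.2.1 i b.1 b.2).1 * (spec s.2.2 i c.1 c.2).1,
    (spec s.1 i a.1 a.2).2, (spec s.2.1 i b.1 b.2).2, (spec s.2.2 i c.1 c.2).2)

/-- All terms of the degree-`deg` component at coordinate `(a, b, c)`. [folklore] -/
def terms (deg : ℕ) (a b c : Fin 3 × Fin 3) : List (ℤ × ℕ × ℕ × ℕ) :=
  (List.finRange 17).flatMap fun i => (pat deg).map (termOf a b c i)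

/-- The right-hand side: `ε ⊗ ε` in degree `2`, zero in degrees `0, 1`.
[cite: ConnerGesmundoLandsbergVentura2022, Thm. 4.2 (proof)] -/
def rhsOf (deg : ℕ) (a b c : Fin 3 × Fin 3) : ℤ :=
  if deg = 2 then leviCivita3Table a.1 b.1 c.1 * leviCivita3Table a.2 b.2 c.2 else 0

/-- The nine cells of a `3 × 3` matrix. [folklore] -/
def cells : List (Fin 3 × Fin 3) :=
  (List.finRange 3).flatMap fun r => (List.finRange 3).map fun c => (r, c)

/-- Check of one coordinate of one component against the memo table. [folklore] -/
def coordCheck (memo : List ((ℕ × ℕ × ℕ) × (List ℕ × KQ))) (deg : ℕ) (a b c : Fin 3 × Fin 3) :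
    Bool :=
  match buckets memo (terms deg a b c) with
  | none => false
  | some bs => checkBuckets (rhsOf deg a b c) bs

/-- The certificate check of the degree-`deg` component: the data are well formed and all `9³`
coordinates pass. [folklore] -/
def Cert.checkDeg (C : Cert) (deg : ℕ) : Bool :=
  C.dataOK &&
    (let memo := C.memo
     cells.all fun a => cells.all fun b => cells.all fun c => coordCheck memo deg a b c)

/-! ## Soundness -/

section Sound

variable {R : Type*} [Field R]

/-- Value of a term `(c, a, b, c')` under `f : ℕ → R`: `c · f a · f b · f c'`. [folklore] -/
def tval (f : ℕ → R) (t : ℤ × ℕ × ℕ × ℕ) : R := (t.1 : R) * (f t.2.1 * f t.2.2.1 * f t.2.2.2)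

/-- Value of a list of terms. [folklore] -/
def tsum (f : ℕ → R) (ts : List (ℤ × ℕ × ℕ × ℕ)) : R := (ts.map (tval f)).sum

/-- Value of a bucket list: `∑ S_ε(y) u^ε`. [folklore] -/
def bval (u : ℕ → R) (y : R) (bs : List (List ℕ × KQ)) : R :=
  (bs.map fun b => b.2.eval y * upow u b.1).sum

/-- `tsum` equation. [folklore] -/
@[simp] theorem tsum_nil (f : ℕ → R) : tsum f [] = 0 := rfl

/-- `tsum` equation. [folklore] -/
@[simp] theorem tsum_cons (f : ℕ → R) (t : ℤ × ℕ × ℕ × ℕ) (ts : List (ℤ × ℕ × ℕ × ℕ)) :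
    tsum f (t :: ts) = tval f t + tsum f ts := by simp [tsum]

/-- `tsum` is additive. [folklore] -/
theorem tsum_append (f : ℕ → R) (a b : List (ℤ × ℕ × ℕ × ℕ)) :
    tsum f (a ++ b) = tsum f a + tsum f b := by simp [tsum, List.sum_append]

/-- `bval` equation. [folklore] -/
@[simp] theorem bval_nil (u : ℕ → R) (y : R) : bval u y [] = 0 := rfl

/-- `bval` equation. [folklore] -/
@[simp] theorem bval_cons (u : ℕ → R) (y : R) (b : List ℕ × KQ) (bs : List (List ℕ × KQ)) :
    bval u y (b :: bs) = b.2.eval y * upow u b.1 + bval u y bs := by simp [bval]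

/-- `mfind` returns members. [folklore] -/
theorem mem_of_mfind {α β : Type} [DecidableEq α] :
    ∀ (l : List (α × β)) (key : α) (v : β), mfind l key = some v → (key, v) ∈ l
  | [], key, v, h => by simp [mfind] at h
  | kv :: rest, key, v, h => by
    simp only [mfind] at h
    split_ifs at h with hk
    · simp only [Option.some.injEq] at h
      subst h; subst hk
      simp
    · exact List.mem_cons_of_mem _ (mem_of_mfind rest key v h)

/-- Sorting three indices permutes the product. [folklore] -/
theorem sort3_prod (f : ℕ → R) (a b c : ℕ) :
    f (sort3 a b c).1 * f (sort3 a b c).2.1 * f (sort3 a b c).2.2 = f a * f b * f c := by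
  unfold sort3 sort2
  split_ifs <;> simp only <;> ring

/-- `tsum` over a `flatMap`. [folklore] -/
theorem tsum_flatMap (f : ℕ → R) {ι : Type} (g : ι → List (ℤ × ℕ × ℕ × ℕ)) :
    ∀ l : List ι, tsum f (l.flatMap g) = (l.map fun i => tsum f (g i)).sum
  | [] => by simp [tsum]
  | i :: l => by
    rw [List.flatMap_cons, tsum_append, tsum_flatMap f g l, List.map_cons, List.sum_cons]

variable [CharZero R]

/-- `addBucket` adds one term to the value. [folklore] -/
theorem bval_addBucket (u : ℕ → R) (y : R) :
    ∀ (bs : List (List ℕ × KQ)) (k : List ℕ) (x : KQ),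
      bval u y (addBucket bs k x) = bval u y bs + x.eval y * upow u k
  | [], k, x => by simp [addBucket]
  | b :: rest, k, x => by
    rw [addBucket]
    split_ifs with h
    · rw [bval_cons, bval_cons, KQ.eval_add, ← h]
      ring
    · rw [bval_cons, bval_cons, bval_addBucket u y rest k x]
      ring

/-- `buckets` regroups the terms: if every memo entry is correct for `f`, the value of the terms
is the value of the buckets. [folklore] -/
theorem tsum_eq_bval (u : ℕ → R) (y : R) (f : ℕ → R)
    (memo : List ((ℕ × ℕ × ℕ) × (List ℕ × KQ)))
    (hmemo : ∀ kv ∈ memo, f kv.1.1 * f kv.1.2.1 * f kv.1.2.2 = kv.2.2.eval y * upow u kv.2.1) :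
    ∀ (ts : List (ℤ × ℕ × ℕ × ℕ)) (bs : List (List ℕ × KQ)),
      buckets memo ts = some bs → tsum f ts = bval u y bs
  | [], bs, h => by
    simp only [buckets, Option.some.injEq] at h
    subst h
    simp
  | t :: ts, bs, h => by
    simp only [buckets] at h
    cases hts : buckets memo ts with
    | none => simp [hts] at h
    | some bs' =>
      simp only [hts] at h
      have ih := tsum_eq_bval u y f memo hmemo ts bs' hts
      by_cases hco : t.1 = 0
      · simp only [hco, if_true, Option.some.injEq] at h
        subst h
        rw [tsum_cons, ih, tval, hco, Int.cast_zero, zero_mul, zero_add]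
      · simp only [hco, if_false] at h
        cases hm : mfind memo (sort3 t.2.1 t.2.2.1 t.2.2.2) with
        | none => simp [hm] at h
        | some kv =>
          simp only [hm, Option.some.injEq] at h
          subst h
          have hmem := mem_of_mfind memo _ kv hm
          have hkv := hmemo _ hmem
          simp only at hkv
          rw [sort3_prod] at hkv
          rw [tsum_cons, ih, bval_addBucket, KQ.eval_smul, tval, hkv]
          ring

/-- Buckets all of whose non-zero classes vanish evaluate to the sum of the class-`0` buckets.
[folklore] -/
theorem bval_eq_lsum (u : ℕ → R) (y : R) :
    ∀ bs : List (List ℕ × KQ), (∀ b ∈ bs, (b.1.isEmpty || b.2.isInt 0) = true) →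
      bval u y bs = (KQ.lsum ((bs.filter fun b => b.1.isEmpty).map fun b => b.2)).eval y
  | [], _ => by simp [KQ.lsum]
  | b :: bs, h => by
    have hb := h b (by simp)
    have ih := bval_eq_lsum u y bs (fun b' hb' => h b' (by simp [hb']))
    rw [bval_cons, ih, List.filter_cons]
    cases he : b.1.isEmpty with
    | true =>
      have h1 : b.1 = [] := List.isEmpty_iff.1 he
      simp [h1, KQ.lsum, KQ.eval_add]
    | false =>
      simp only [he, Bool.false_or] at hb
      simp [KQ.eval_of_isInt y _ _ hb]

/-- `checkBuckets` is sound. [folklore] -/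
theorem bval_of_checkBuckets (u : ℕ → R) (y : R) (rhs : ℤ) (bs : List (List ℕ × KQ))
    (h : checkBuckets rhs bs = true) : bval u y bs = rhs := by
  simp only [checkBuckets, Bool.and_eq_true, List.all_eq_true] at h
  rw [bval_eq_lsum u y bs h.1, KQ.eval_of_isInt y _ _ h.2]

/-! ### The memo entries are correct -/

/-- A property of the default and of all members holds at `List.getD`. [folklore] -/
theorem getD_prop {α : Type} (P : α → Prop) (d : α) (hd : P d) :
    ∀ (l : List α) (n : ℕ), (∀ x ∈ l, P x) → P (l.getD n d)
  | [], n, _ => by simpa using hd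
  | x :: xs, 0, h => by simpa using h x (by simp)
  | x :: xs, n + 1, h => by
    simpa using getD_prop P d hd xs n (fun x' hx' => h x' (by simp [hx']))

variable (C : Cert)

/-- Well-formed data: every `r_j` has length `≤ 27`. [folklore] -/
theorem length_rAt (hC : C.dataOK = true) (j : ℕ) : (C.rAt j).num.length ≤ 27 := by
  simp only [Cert.dataOK, Bool.and_eq_true, List.all_eq_true, decide_eq_true_eq] at hC
  unfold Cert.rAt
  split_ifs
  · exact getD_prop (fun r : KQ => r.num.length ≤ 27) KQ.one (by simp [KQ.one]) C.R (j - 1) hC.1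
  · simp [KQ.one]

/-- Well-formed data: every `Wᵢ` has length `≤ 27`. [folklore] -/
theorem length_W (hC : C.dataOK = true) : ∀ w ∈ C.W, w.num.length ≤ 27 := by
  simp only [Cert.dataOK, Bool.and_eq_true, List.all_eq_true, decide_eq_true_eq] at hC
  exact hC.2

/-- The pair table only caches `r_a r_b`. [folklore] -/
theorem pairVal_eq (pm : List ((ℕ × ℕ) × KQ)) (hpm : ∀ kv ∈ pm, kv.2 = KQ.mul (C.rAt kv.1.1) (C.rAt kv.1.2))
    (p : ℕ × ℕ) : C.pairVal pm p = KQ.mul (C.rAt p.1) (C.rAt p.2) := by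
  unfold Cert.pairVal
  cases h : mfind pm p with
  | none => rfl
  | some v => exact hpm _ (mem_of_mfind pm p v h)

/-- The entries of the pair table are the products `r_a r_b`. [folklore] -/
theorem pmemo_prop : ∀ kv ∈ C.pmemo, kv.2 = KQ.mul (C.rAt kv.1.1) (C.rAt kv.1.2) := by
  intro kv hkv
  simp only [Cert.pmemo, List.mem_map] at hkv
  obtain ⟨p, _, rfl⟩ := hkv
  rfl

/-- The real-side data of a certificate: a root `y` of `p` and real numbers `uᵢ` with
`uᵢ³ = Wᵢ(y)` (`uᵢ³ = 1` beyond the radicand list). [folklore] -/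
structure Model (C : Cert) where
  /-- a real root of `p` -/
  y : ℝ
  /-- `p(y) = 0` -/
  hy : peval y pP = 0
  /-- the radicals -/
  u : ℕ → ℝ
  /-- `uᵢ³ = Wᵢ(y)` -/
  hu : ∀ i, u i ^ 3 = (C.W.getD i KQ.one).eval y

variable {C}

/-- The value of the index `j ∈ {0, …, 44}`: `r_j(y) · ∏ uᵢ^{e_ji}` (`= 1` for `j = 0`). [folklore] -/
def Model.val (M : Model C) (j : ℕ) : ℝ := (C.rAt j).eval M.y * upow M.u (C.eAt j)

/-- **The solution** `z_j = r_j(y*) ∏ᵢ uᵢ^{e_ji}`, `j = 1, …, 44` (as a `Fin 44`-vector).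
[cite: ConnerGesmundoLandsbergVentura2022, Thm. 4.2 (proof)] -/
def Model.z (M : Model C) (j : Fin 44) : ℝ := M.val (j.val + 1)

/-- `br17Param` of the solution is `Model.val` at every index. [folklore] -/
theorem Model.br17Param_z (M : Model C) (j : ℕ) : br17Param M.z j = M.val j := by
  unfold br17Param
  split_ifs with h
  · simp only [Model.z]
    rw [Nat.sub_add_cancel h.1]
  · simp [Model.val, Cert.rAt, Cert.eAt, h]

/-- The memo entries are correct: `z_a z_b z_c = V(y) · u^ε`. [folklore] -/
theorem Model.entry_sound (M : Model C) (hC : C.dataOK = true) (pm : List ((ℕ × ℕ) × KQ))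
    (hpm : ∀ kv ∈ pm, kv.2 = KQ.mul (C.rAt kv.1.1) (C.rAt kv.1.2)) (t : ℕ × ℕ × ℕ) :
    M.val t.1 * M.val t.2.1 * M.val t.2.2 =
      (C.entry pm t).2.eval M.y * upow M.u (C.entry pm t).1 := by
  have hr := length_rAt C hC
  obtain ⟨hw1, hw2⟩ := upow_cube_eq_wpow M.hy C.W
    ((vadd (vadd (C.eAt t.1) (C.eAt t.2.1)) (C.eAt t.2.2)).map (· / 3)) M.u M.hu (length_W C hC)
  simp only [Cert.entry, Model.val]
  rw [upow_vtrim, KQ.eval_mul M.hy _ _ (KQ.length_mul _ _) hw2, ← hw1,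
    KQ.eval_mul M.hy _ _ (by rw [pairVal_eq C pm hpm]; exact KQ.length_mul _ _) (hr _),
    pairVal_eq C pm hpm, KQ.eval_mul M.hy _ _ (hr _) (hr _)]
  conv_lhs => rw [show ∀ a b c d e f : ℝ, a * b * (c * d) * (e * f) = (a * c * e) * (b * d * f)
    from fun a b c d e f => by ring, ← upow_vadd, ← upow_vadd, upow_modDiv]
  ring

/-- Hence every memo entry is correct. [folklore] -/
theorem Model.memo_sound (M : Model C) (hC : C.dataOK = true) :
    ∀ kv ∈ C.memo, M.val kv.1.1 * M.val kv.1.2.1 * M.val kv.1.2.2 =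
      kv.2.2.eval M.y * upow M.u kv.2.1 := by
  intro kv hkv
  simp only [Cert.memo, List.mem_map] at hkv
  obtain ⟨t, _, rfl⟩ := hkv
  exact M.entry_sound hC C.pmemo (pmemo_prop C) t

/-- One coordinate: a passing check gives the value `rhs`. [folklore] -/
theorem Model.tsum_terms_eq (M : Model C) (hC : C.dataOK = true) (deg : ℕ) (a b c : Fin 3 × Fin 3)
    (h : coordCheck C.memo deg a b c = true) :
    tsum M.val (terms deg a b c) = rhsOf deg a b c := by
  unfold coordCheck at h
  cases hb : buckets C.memo (terms deg a b c) with
  | none => simp [hb] at h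
  | some bs =>
    simp only [hb] at h
    rw [tsum_eq_bval M.u M.y M.val C.memo (M.memo_sound hC) _ bs hb, bval_of_checkBuckets _ _ _ _ h]

/-! ### The symbolic terms compute the system -/

/-- A factor of the system: `A_i` or `B_i` at a cell. [folklore] -/
theorem tval_termOf (z : Fin 44 → ℝ) (a b c : Fin 3 × Fin 3) (i : Fin 17) (s : Bool × Bool × Bool) :
    tval (br17Param z) (termOf a b c i s) =
      br17Eval z (spec s.1 i a.1 a.2) * br17Eval z (spec s.2.1 i b.1 b.2) *
        br17Eval z (spec s.2.2 i c.1 c.2) := by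
  simp only [tval, termOf, br17Eval]
  push_cast
  ring

/-- The terms of a coordinate, summed row by row. [folklore] -/
theorem tsum_terms (f : ℕ → ℝ) (deg : ℕ) (a b c : Fin 3 × Fin 3) :
    tsum f (terms deg a b c) = ∑ i : Fin 17, tsum f ((pat deg).map (termOf a b c i)) := by
  rw [terms, tsum_flatMap, Fin.sum_univ_def]

/-- The `t⁰` component of `∑ᵢ L_i(t)^{⊗3}` is the value of `terms 0`. [cite: ConnerGesmundoLandsbergVentura2022, Thm. 4.2 (proof)] -/
theorem sys0_eq (z : Fin 44 → ℝ) (a b c : Fin 3 × Fin 3) :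
    ∑ i, cglvBr17Const z i a * cglvBr17Const z i b * cglvBr17Const z i c =
      tsum (br17Param z) (terms 0 a b c) := by
  rw [tsum_terms]
  refine Finset.sum_congr rfl fun i _ => ?_
  simp only [pat, List.map_cons, List.map_nil, tsum_cons, tsum_nil, tval_termOf, spec,
    cglvBr17Const, add_zero]

/-- The `t¹` component of `∑ᵢ L_i(t)^{⊗3}` is the value of `terms 1`. [cite: ConnerGesmundoLandsbergVentura2022, Thm. 4.2 (proof)] -/
theorem sys1_eq (z : Fin 44 → ℝ) (a b c : Fin 3 × Fin 3) :
    ∑ i, (cglvBr17Const z i a * cglvBr17Const z i b * cglvBr17Lin z i c +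
        cglvBr17Const z i a * cglvBr17Lin z i b * cglvBr17Const z i c +
        cglvBr17Lin z i a * cglvBr17Const z i b * cglvBr17Const z i c) =
      tsum (br17Param z) (terms 1 a b c) := by
  rw [tsum_terms]
  refine Finset.sum_congr rfl fun i _ => ?_
  simp only [pat, List.map_cons, List.map_nil, tsum_cons, tsum_nil, tval_termOf, spec,
    cglvBr17Const, cglvBr17Lin, add_zero, add_assoc]

/-- The `t²` component of `∑ᵢ L_i(t)^{⊗3}` is the value of `terms 2`. [cite: ConnerGesmundoLandsbergVentura2022, Thm. 4.2 (proof)] -/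
theorem sys2_eq (z : Fin 44 → ℝ) (a b c : Fin 3 × Fin 3) :
    ∑ i, (cglvBr17Const z i a * cglvBr17Lin z i b * cglvBr17Lin z i c +
        cglvBr17Lin z i a * cglvBr17Const z i b * cglvBr17Lin z i c +
        cglvBr17Lin z i a * cglvBr17Lin z i b * cglvBr17Const z i c) =
      tsum (br17Param z) (terms 2 a b c) := by
  rw [tsum_terms]
  refine Finset.sum_congr rfl fun i _ => ?_
  simp only [pat, List.map_cons, List.map_nil, tsum_cons, tsum_nil, tval_termOf, spec,
    cglvBr17Const, cglvBr17Lin, add_zero, add_assoc]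

/-- `cells` lists every cell. [folklore] -/
theorem mem_cells (a : Fin 3 × Fin 3) : a ∈ cells := by
  obtain ⟨r, c⟩ := a
  simp [cells]

/-- **Soundness of the certificate check**: if the three degree slices pass, the real vector
`z` of any model solves `CGLVBr17System`. [cite: ConnerGesmundoLandsbergVentura2022, Thm. 4.2 (proof)] -/
theorem Model.system (M : Model C) (h : ∀ d, d < 3 → C.checkDeg d = true) : CGLVBr17System M.z := by
  have key : ∀ d, d < 3 → ∀ a b c : Fin 3 × Fin 3,
      tsum (br17Param M.z) (terms d a b c) = rhsOf d a b c := by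
    intro d hd a b c
    have hc := h d hd
    simp only [Cert.checkDeg, Bool.and_eq_true, List.all_eq_true] at hc
    obtain ⟨hdata, hall⟩ := hc
    have hval : br17Param M.z = M.val := funext M.br17Param_z
    rw [hval]
    exact M.tsum_terms_eq hdata d a b c (hall a (mem_cells a) b (mem_cells b) c (mem_cells c))
  refine ⟨fun a b c => ?_, fun a b c => ?_, fun a b c => ?_⟩
  · rw [sys0_eq, key 0 (by norm_num)]
    simp [rhsOf]
  · rw [sys1_eq, key 1 (by norm_num)]
    simp [rhsOf]
  · rw [sys2_eq, key 2 (by norm_num)]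
    simp [rhsOf, det3Target]

end Sound

/-! ## Real roots and the real solution -/

/-- `y ↦ l(y)` is continuous. [folklore] -/
theorem continuous_peval (l : List ℤ) : Continuous fun y : ℝ => peval y l := by
  induction l with
  | nil => simpa using continuous_const
  | cons c cs ih =>
    show Continuous fun y : ℝ => (c : ℝ) + y * peval y cs
    exact continuous_const.add (continuous_id.mul ih)

/-- `p` has a real root (in `[-4, -3]`: `p(-4) < 0 < p(-3)`; it is `y* ≈ -3.1197`).
[cite: ConnerGesmundoLandsbergVentura2022, Thm. 4.2 (proof)] -/
theorem exists_root_pP : ∃ y : ℝ, peval y pP = 0 := by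
  have h4 : peval (-4 : ℝ) pP ≤ 0 := by norm_num [peval, pP]
  have h3 : 0 ≤ peval (-3 : ℝ) pP := by norm_num [peval, pP]
  obtain ⟨y, _, hy⟩ := intermediate_value_Icc (show (-4 : ℝ) ≤ -3 by norm_num)
    (continuous_peval pP).continuousOn ⟨h4, h3⟩
  exact ⟨y, hy⟩

/-- Real cube roots exist. [folklore] -/
theorem exists_cube_root (x : ℝ) : ∃ u : ℝ, u ^ 3 = x := by
  rcases le_or_gt 0 x with hx | hx
  · refine ⟨x ^ ((1 : ℝ) / 3), ?_⟩
    rw [← Real.rpow_natCast, ← Real.rpow_mul hx]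
    norm_num
  · refine ⟨-((-x) ^ ((1 : ℝ) / 3)), ?_⟩
    rw [Odd.neg_pow (by decide), ← Real.rpow_natCast, ← Real.rpow_mul (by linarith)]
    norm_num

/-- **A passing certificate yields the named fact**: `CGLVBr17System` has a real solution.
[cite: ConnerGesmundoLandsbergVentura2022, Thm. 4.2 (proof)] -/
theorem Cert.realSolution (C : Cert) (h : ∀ d, d < 3 → C.checkDeg d = true) :
    CGLV2022_br17RealSolution := by
  obtain ⟨y, hy⟩ := exists_root_pP
  choose u hu using fun i : ℕ => exists_cube_root ((C.W.getD i KQ.one).eval y)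
  exact ⟨Model.z (C := C) ⟨y, hy, u, hu⟩, Model.system _ h⟩

end Br17Cert

end Literature.Computability.AlgebraicComplexity
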